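import Summits.AtomisticToContinuum.HydrodynamicLimit.Theorems.AntiMazurCoboundariesInfluenceLocalityTrueCapsExistPrelimA
import Summits.AtomisticToContinuum.HydrodynamicLimit.Theorems.AntiMazurCoboundariesInfluenceLocalityTrueCapsExistPrelimD
import Summits.AtomisticToContinuum.HydrodynamicLimit.Theorems.AntiMazurCoboundariesInfluenceLocalityTrueCapsExistPrelimE

/-!
# Prelim G of stub `stub_trueCapsExist` (line `true-anchored-infection`, crux `InfluenceLocality`,
# stmt-AtomisticToContinuum-13916; route AntiMazurCoboundaries): assembly of the bound for the hot
# event at fixed range `R` and particle number `N`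

The TRUE-SIDE HOT EVENT of the line, `IsHot σ T N Φ c u R' · i` (some true sphere `j` is `u`-fast
relative to the drift `c` at some rational grid time `Tℓq`, `q ∈ [0, 1]`, while within `R'ℓ` of
the INITIAL position of sphere `i`; `R' = R + haloMargin c σ T u`), is covered on the good set by

* sphere `i` itself becoming fast during `[0, Tℓ]` — by the flight-start alternative
  (`TrueCaps.fast_decomp₀`) either fast at time `0` (a Maxwellian tail, `gibbs_fastAt_le`) or fast
  right after one of its collisions (the collision sum of `trueCaps_rice_self`);
* otherwise sphere `i` is slow, hence displaced by at most `(u + ‖c‖) Tℓ`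
  (`TrueCaps.euclidDist_le_of_norm_vel_le`), so the witness `j ≠ i` is fast and within
  `ρ = R'ℓ + (u + ‖c‖) Tℓ` of the CURRENT position of `i`; by `trueCaps_fast_decomp` either this
  holds at time `0` with radius `ρ + (‖v_j‖ + u + ‖c‖) Tℓ` (the ball term, `gibbs_nearFastAt_le`,
  `TrueCaps.lintegral_ball_le`) or right after a collision of `j` (the collision sum of
  `trueCaps_rice_other`).

Adding up (`trueCaps_isHot_le`, registered prelim):
`G_N{IsHot} ≤ tailC + 16 N ε² τ I_fast + N · (4 vol(B₁) J₁ + 16 ε² τ I_fast + 32 (N+1) ε² τ vol(B₁) J₃)`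
with `ε = σℓ`, `τ = Tℓ` and the Gaussian integrals `I_fast, J₁, J₃` of Prelim B — every factor of
`N` is compensated by `ε² τ ∝ ℓ³` or by the `ℓ³` inside `J₁, J₃` (next file).
-/

namespace Summit.AtomisticToContinuum.HydrodynamicLimit.Theorems.TrueAnchoredInfection

open MeasureTheory Set Filter Topology
open scoped ENNReal
open Literature.Analysis.FluidPDE Literature.MathematicalPhysics.KineticTheory
open Literature.Analysis.FunctionSpaces

noncomputable section

namespace TrueCaps

variable {σ a θ : ℝ} {N : ℕ}

/-- **The time-`0` fast event of one sphere is a Maxwellian tail**: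
`G_N{u < ‖v_i - c‖} ≤ 2^{3/2} e^{-u²/(4θ)}`. -/
theorem gibbs_fastAt_le (c : V3) (Φ : Flow σ N) (hσ2 : σ ≤ 1 / 2) (ha : 0 < a) (hθ : 0 < θ) {u : ℝ}
    (hu : 0 ≤ u) (i : Fin (N + 1)) :
    gibbs σ a θ c N Φ {z | u < ‖(z i).2 - c‖} ≤ ENNReal.ofReal (tailC θ u) := by
  set Q := posGibbsMeasure (fun _ : T3 => a) (hsDiameter σ N) (N + 1) with hQ
  set Γ : Measure (Fin (N + 1) → V3) := Measure.pi fun _ => gaussMeasure c θ with hΓ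
  have hlaw : gibbs σ a θ c N Φ = (Q.prod Γ).map zipConfig := by
    rw [gibbs, localGibbsLaw_eq, localGibbsMeasure_rung0_eq_map σ ha.le hθ c N]
  haveI : IsProbabilityMeasure Q := isProbabilityMeasure_posGibbsMeasure continuous_const (fun _ => ha) hσ2 N
  have hSm : MeasurableSet {v : V3 | u < ‖v - c‖} := measurableSet_lt measurable_const (measurable_id.sub measurable_const).norm
  have hAm : MeasurableSet {z : Phase N | u < ‖(z i).2 - c‖} :=
    measurableSet_lt measurable_const ((measurable_pi_apply i).snd.sub measurable_const).norm
  have hpre : zipConfig ⁻¹' {z : Phase N | u < ‖(z i).2 - c‖} =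
      (univ : Set (Fin (N + 1) → T3)) ×ˢ ((fun v : Fin (N + 1) → V3 => v i) ⁻¹' {v : V3 | u < ‖v - c‖}) := by
    ext p; simp [zipConfig_apply]
  rw [hlaw, Measure.map_apply measurable_zipConfig hAm, hpre, Measure.prod_prod, measure_univ, one_mul, hΓ,
    (measurePreserving_eval (fun _ : Fin (N + 1) => gaussMeasure c θ) i).measure_preimage hSm.nullMeasurableSet]
  exact measure_fast_le hθ hu c

/-- **The time-`0` near-and-fast event of a sphere `j ≠ i` is a ball term**:
`G_N{u < ‖v_j - c‖, dist(x_j, x_i) < ρ + (‖v_j‖ + V) τ} ≤ 4 vol(B₁) · J₁` (`TrueCaps.lintegral_ball_le`). -/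
theorem gibbs_nearFastAt_le (c : V3) (Φ : Flow σ N) (hsd : SmallDensity uniformProfile σ) (ha : 0 < a) (hθ : 0 < θ)
    (hN : 1 ≤ N) {u ρ V τ : ℝ} (hρ : 0 ≤ ρ) (hV : 0 ≤ V) (hτ : 0 ≤ τ) {j i : Fin (N + 1)} (hji : j ≠ i) :
    gibbs σ a θ c N Φ {z | u < ‖(z j).2 - c‖ ∧ Torus.euclidDist (z j).1 (z i).1 < ρ + (‖(z j).2‖ + V) * τ} ≤
      4 * volume (Metric.ball (0 : V3) 1) * ballFlux c θ u ρ V τ := by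
  set B : Set (Phase N) := {z | u < ‖(z j).2 - c‖ ∧ Torus.euclidDist (z j).1 (z i).1 < ρ + (‖(z j).2‖ + V) * τ} with hB
  have hdm : Measurable fun z : Phase N => Torus.euclidDist (z j).1 (z i).1 :=
    (Torus.measurable_reprSym.comp ((measurable_pi_apply j).fst.sub (measurable_pi_apply i).fst)).norm
  have hBm : MeasurableSet B :=
    (measurableSet_lt measurable_const ((measurable_pi_apply j).snd.sub measurable_const).norm).inter
      (measurableSet_lt hdm ((((measurable_pi_apply j).snd.norm.add measurable_const).mul measurable_const).const_add ρ))
  have heq : (B.indicator (1 : Phase N → ℝ≥0∞)) = {w : Phase N | Torus.euclidDist (w j).1 (w i).1 < ρ + (‖(w j).2‖ + V) * τ}.indicator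
      fun w => {v : V3 | u < ‖v - c‖}.indicator 1 (w j).2 := by
    funext w
    simp only [hB, indicator, mem_setOf_eq, Pi.one_apply]
    by_cases h1 : u < ‖(w j).2 - c‖ <;> by_cases h2 : Torus.euclidDist (w j).1 (w i).1 < ρ + (‖(w j).2‖ + V) * τ <;> simp [h1, h2]
  rw [← lintegral_indicator_one hBm, heq]
  have h := lintegral_ball_le c Φ (W := fun v => {v : V3 | u < ‖v - c‖}.indicator 1 v) (ρ := fun v => ρ + (‖v‖ + V) * τ)
    hsd ha hθ hN hji (measurable_one.indicator (measurableSet_lt measurable_const (measurable_id.sub measurable_const).norm))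
    (((measurable_norm.add measurable_const).mul measurable_const).const_add ρ) (fun v => by positivity)
  exact h

/-- A rational grid time `Tℓq`, `q ∈ [0, 1]`, lies in `[0, Tℓ]`. -/
theorem gridTime_mem {T : ℝ} (hT : 0 ≤ T) (N : ℕ) {q : ℚ} (hq0 : 0 ≤ q) (hq1 : q ≤ 1) :
    T * ell N * q ∈ Icc 0 (T * ell N) := by
  have hℓ : 0 ≤ ell N := Real.rpow_nonneg (Nat.cast_nonneg _) _
  have hq0' : (0 : ℝ) ≤ q := by exact_mod_cast hq0
  have hq1' : (q : ℝ) ≤ 1 := by exact_mod_cast hq1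
  exact ⟨by positivity, by nlinarith [mul_nonneg hT hℓ]⟩

end TrueCaps

open TrueCaps in
/-- **Registered prelim `trueCaps_isHot_le`** (of `stub_trueCapsExist`): the bound for the hot event
at fixed range and particle number. For `SmallDensity uniformProfile σ`, `a, θ, T > 0`,
`R, u ≥ 0`, `N ≥ 1`, every flow `Φ` and label `i`, with `ε = hsDiameter σ N`, `τ = T · ell N`,
`V = u + ‖c‖`, `ρ = (R + haloMargin c σ T u) ell N + V τ`:
`G_N{IsHot σ T N Φ c u (R + haloMargin c σ T u) · i}
  ≤ tailC θ u + 16 N ε² τ · I_fast + N · (4 vol(B₁) J₁ + (16 ε² τ I_fast + 32 (N+1) ε² τ vol(B₁) J₃))`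
(`I_fast = fastFlux c θ u`, `J₁ = ballFlux c θ u ρ V τ`, `J₃ = nearFlux c θ u ρ V τ`). -/
theorem trueCaps_isHot_le : ∀ (σ a θ : ℝ) (c : V3) (N : ℕ) (Φ : Flow σ N) (T R u : ℝ) (i : Fin (N + 1)), SmallDensity uniformProfile σ → 0 < a → 0 < θ → 0 < T → 0 ≤ R → 0 ≤ u → 1 ≤ N → gibbs σ a θ c N Φ {z | IsHot σ T N Φ c u (R + haloMargin c σ T u) z i} ≤ ENNReal.ofReal (TrueCaps.tailC θ u) + ENNReal.ofReal (16 * N * hsDiameter σ N ^ 2 * (T * ell N)) * TrueCaps.fastFlux c θ u + N * (4 * MeasureTheory.volume (Metric.ball (0 : V3) 1) * TrueCaps.ballFlux c θ u ((R + haloMargin c σ T u) * ell N + (u + ‖c‖) * (T * ell N)) (u + ‖c‖) (T * ell N) + (ENNReal.ofReal (16 * hsDiameter σ N ^ 2 * (T * ell N)) * TrueCaps.fastFlux c θ u + ENNReal.ofReal (32 * (N + 1) * hsDiameter σ N ^ 2 * (T * ell N)) * MeasureTheory.volume (Metric.ball (0 : V3) 1) * TrueCaps.nearFlux c θ u ((R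 + haloMargin c σ T u) * ell N + (u + ‖c‖) * (T * ell N)) (u + ‖c‖) (T * ell N))) := by
  intro σ a θ c N Φ T R u i hsd ha hθ hT hR hu hN
  classical
  have hσ2 : σ ≤ 1 / 2 := hsd.σ_lt_half.le
  have hσ0 : 0 ≤ σ := hsd.σ_pos.le
  set τ := T * ell N with hτdef
  have hℓ : 0 < ell N := Real.rpow_pos_of_pos (by positivity) _
  have hτ : 0 < τ := mul_pos hT hℓ
  set V := u + ‖c‖ with hVdef
  have hV : 0 ≤ V := by positivity
  set R' := R + haloMargin c σ T u with hR'def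
  have hR' : 0 ≤ R' := by rw [hR'def, haloMargin]; positivity
  set ρ := R' * ell N + V * τ with hρdef
  have hρ : 0 ≤ ρ := by positivity
  set P := gibbs σ a θ c N Φ with hP
  -- the five events
  set A0 : Set (Phase N) := {z | u < ‖(z i).2 - c‖} with hA0
  set Fs : Phase N → Fin (N + 1) → Fin (N + 1) → ℝ≥0∞ := fun w i' _ => if i' = i ∧ u < ‖(w i).2 - c‖ then 1 else 0 with hFs
  set As : Set (Phase N) := {z | z ∈ Φ.good ∧ 1 ≤ collSum Φ τ Fs z} with hAs
  set B0 : Fin (N + 1) → Set (Phase N) := fun j =>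
    {z | u < ‖(z j).2 - c‖ ∧ Torus.euclidDist (z j).1 (z i).1 < ρ + (‖(z j).2‖ + V) * τ} with hB0
  set Fo : Fin (N + 1) → Phase N → Fin (N + 1) → Fin (N + 1) → ℝ≥0∞ := fun j w j' _ =>
    if j' = j ∧ (u < ‖(w j).2 - c‖ ∧ Torus.euclidDist (w j).1 (w i).1 < ρ + (‖(w j).2‖ + V) * τ) then 1 else 0 with hFo
  set Bc : Fin (N + 1) → Set (Phase N) := fun j => {z | z ∈ Φ.good ∧ 1 ≤ collSum Φ τ (Fo j) z} with hBc
  -- the cover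
  have hcover : {z | IsHot σ T N Φ c u R' z i} ⊆
      Φ.goodᶜ ∪ ((A0 ∪ As) ∪ ⋃ j ∈ (Finset.univ.erase i : Finset (Fin (N + 1))), (B0 j ∪ Bc j)) := by
    intro z hz
    by_cases hgood : z ∈ Φ.good
    swap
    · exact Or.inl hgood
    right
    obtain ⟨j, q, hq0, hq1, hfast, hnear⟩ := hz
    have hs : T * ell N * q ∈ Icc 0 τ := gridTime_mem hT.le N hq0 hq1
    set s := T * ell N * q with hsdef
    have htraj := Φ.isTrajectory z hgood
    by_cases hA : ∃ t ∈ Icc 0 τ, u < ‖(Φ.flow t z i).2 - c‖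
    · -- sphere `i` itself gets fast
      left
      rcases fast_decomp₀ Φ hgood i c hA with h0 | ⟨r, hr, k, hik, hc, hfr⟩
      · exact Or.inl h0
      · refine Or.inr ⟨hgood, ?_⟩
        have h1 : Fs (Φ.flow r z) i k = 1 := by simp only [hFs, true_and, if_pos hfr]
        rw [← h1]
        exact le_collSum_of_contact Φ Fs hgood hr hik hc
    · -- sphere `i` is slow on `[0, τ]`: the witness is another sphere, near the current `x_i`
      push Not at hA
      have hji : j ≠ i := by
        rintro rfl
        exact absurd (hA s hs) (not_le.2 hfast)
      have hVi : ∀ t ∈ Icc 0 τ, ‖(Φ.flow t z i).2‖ ≤ V := by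
        intro t ht
        calc ‖(Φ.flow t z i).2‖ = ‖((Φ.flow t z i).2 - c) + c‖ := by rw [sub_add_cancel]
          _ ≤ ‖(Φ.flow t z i).2 - c‖ + ‖c‖ := norm_add_le _ _
          _ ≤ u + ‖c‖ := add_le_add (hA t ht) le_rfl
      have hdisp : Torus.euclidDist (Φ.flow s z i).1 (z i).1 ≤ V * τ := by
        have h1 := euclidDist_le_of_norm_vel_le htraj hs.1 (j := i) (V := V) fun t ht => hVi t ⟨ht.1, ht.2.trans hs.2⟩
        rw [Φ.flow_zero z hgood, sub_zero] at h1
        exact h1.trans (mul_le_mul_of_nonneg_left hs.2 hV)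
      have hnear' : Torus.euclidDist (Φ.flow s z j).1 (Φ.flow s z i).1 < ρ := by
        calc Torus.euclidDist (Φ.flow s z j).1 (Φ.flow s z i).1
            ≤ Torus.euclidDist (Φ.flow s z j).1 (z i).1 + Torus.euclidDist (z i).1 (Φ.flow s z i).1 :=
              euclidDist_triangle _ _ _
          _ < R' * ell N + V * τ := by
              rw [Torus.euclidDist_comm (z i).1]
              exact add_lt_add_of_lt_of_le hnear hdisp
      right
      simp only [mem_iUnion, Finset.mem_erase, Finset.mem_univ, and_true, exists_prop]
      refine ⟨j, hji, ?_⟩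
      rcases trueCaps_fast_decomp σ N Φ z hgood i j c τ u ρ V hVi ⟨s, hs, hfast, hnear'⟩ with h0 | ⟨r, hr, k, hjk, hc, hfr, hnr⟩
      · exact Or.inl h0
      · refine Or.inr ⟨hgood, ?_⟩
        have h1 : Fo j (Φ.flow r z) j k = 1 := by simp only [hFo, true_and, if_pos (And.intro hfr hnr)]
        rw [← h1]
        exact le_collSum_of_contact Φ (Fo j) hgood hr hjk hc
  -- the five bounds
  have h0 : P Φ.goodᶜ = 0 := withDensity_absolutelyContinuous _ _ Φ.measure_compl_good
  have h1 : P A0 ≤ ENNReal.ofReal (tailC θ u) := gibbs_fastAt_le c Φ hσ2 ha hθ hu i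
  have h2 : P As ≤ ENNReal.ofReal (16 * N * hsDiameter σ N ^ 2 * τ) * fastFlux c θ u :=
    trueCaps_rice_self σ a θ c N Φ τ u i hsd ha hθ hN hτ
  have h3 : ∀ j, j ≠ i → P (B0 j) ≤ 4 * volume (Metric.ball (0 : V3) 1) * ballFlux c θ u ρ V τ :=
    fun j hji => gibbs_nearFastAt_le c Φ hsd ha hθ hN hρ hV hτ.le hji
  have h4 : ∀ j, j ≠ i → P (Bc j) ≤ ENNReal.ofReal (16 * hsDiameter σ N ^ 2 * τ) * fastFlux c θ u +
      ENNReal.ofReal (32 * (N + 1) * hsDiameter σ N ^ 2 * τ) * volume (Metric.ball (0 : V3) 1) * nearFlux c θ u ρ V τ :=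
    fun j hji => trueCaps_rice_other σ a θ c N Φ τ u ρ V i j hsd ha hθ hN hτ hρ hV hji
  -- add up
  have hcard : ((Finset.univ.erase i : Finset (Fin (N + 1))).card : ℝ≥0∞) = N := by
    rw [Finset.card_erase_of_mem (Finset.mem_univ i), Finset.card_univ, Fintype.card_fin, Nat.add_sub_cancel]
  calc P {z | IsHot σ T N Φ c u R' z i}
      ≤ P Φ.goodᶜ + (P (A0 ∪ As) + P (⋃ j ∈ (Finset.univ.erase i : Finset (Fin (N + 1))), (B0 j ∪ Bc j))) :=
        (measure_mono hcover).trans ((measure_union_le _ _).trans (add_le_add le_rfl (measure_union_le _ _)))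
    _ ≤ 0 + ((P A0 + P As) + ∑ j ∈ (Finset.univ.erase i : Finset (Fin (N + 1))), P (B0 j ∪ Bc j)) := by
        rw [h0]
        exact add_le_add le_rfl (add_le_add (measure_union_le _ _) (measure_biUnion_finset_le _ _))
    _ ≤ 0 + ((ENNReal.ofReal (tailC θ u) + ENNReal.ofReal (16 * N * hsDiameter σ N ^ 2 * τ) * fastFlux c θ u) +
          ∑ j ∈ (Finset.univ.erase i : Finset (Fin (N + 1))),
            (4 * volume (Metric.ball (0 : V3) 1) * ballFlux c θ u ρ V τ +
              (ENNReal.ofReal (16 * hsDiameter σ N ^ 2 * τ) * fastFlux c θ u +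
                ENNReal.ofReal (32 * (N + 1) * hsDiameter σ N ^ 2 * τ) * volume (Metric.ball (0 : V3) 1) *
                  nearFlux c θ u ρ V τ))) := by
        refine add_le_add le_rfl (add_le_add (add_le_add h1 h2) (Finset.sum_le_sum fun j hj => ?_))
        have hji : j ≠ i := (Finset.mem_erase.1 hj).1
        exact (measure_union_le _ _).trans (add_le_add (h3 j hji) (h4 j hji))
    _ = _ := by
        rw [zero_add, Finset.sum_const, nsmul_eq_mul, hcard]

end

end Summit.AtomisticToContinuum.HydrodynamicLimit.Theorems.TrueAnchoredInfection
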